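import Summits.BirchSwinnertonDyer.Rank1Residual.F1Sign2.LevelZeroSpinLawPosDiscAtTwoKernel
import HarnessLib.Audit.Tags
import HarnessLib

/-!
# DESC-43 «Δ_L > 0 COMPLETE» — the UNIT BOUND, the ODD EGG-RESCUE CELL, the lone-odd-place law (LAW 43) and the multi-place law in the totally real regime (-desc g33, MEMO-desc §43; typer -ty g21)

PORT (typer -ty g21, cell bsd-f1-sign2) of -desc g33's `MEMO-desc-data/g33/lean/Sketch43.lean` cb1723bae0b43a83 (= REF1-frozen `REF1-data/b283/Sketch43_asis.lean`; MEMO-desc §43, posted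
2026-08-30T00:56:49Z; rc 0 · 0 err · 0 warn · 0 sorry · -desc BC7 8/8 rows + 2/2 carrier probes CLEAN), as the planner asked: ONE statement file (this) + the kernel sibling
`LevelZeroSpinLawPosDiscOddAtTwoKernel.lean` (imports the DESC-42 kernel `LevelZeroSpinLawPosDiscAtTwoKernel.lean`, p751453).  CARRIERS `OddEggRescueCellAt W c F v ℓ` (`ℓ ≠ 2`, switched
ON (sharp), three local roots, `c_v = 4`, type `I_n*` with `4 ∣ n` incl. `I₀*` — THM 40.1's cell `(k, λ) = (0, 0)`; the local type of every admissible split-prime twist),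
`AlignmentExcludingOddCellAt W c F v ℓ` (`d = 1` with 𝔯 odd, or three roots and multiplicative `I_n`, `n ≡ 2 (4)`); ROWS: PLAIN **DESC-43-U** `EggAlignedOfSelmerFourAllOffAtTwo` (THM
43.0, dim-2 case), **DESC-43-U′** `SelmerTwoCardLeOfAllOffAtTwo` (THM 43.0, the bound; sign-free), **DESC-43-T** `NotEggAlignedOfLoneVisibleOddPlaceAtTwo` (THM 43.2's alignment
exclusions); `@[conjecture]` **DESC-43-L** `LevelZeroSpinLawPosDiscLoneOddPlaceAtTwo` (LAW 43, `↔`), **DESC-43-A** `PureSpinLawOfEggAlignedOddIstarAtTwo`, **DESC-43-B**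
`SpinObstructedOfMisalignedOddIstarAtTwo`, **DESC-43-M** `TwoRescuedPlacesOfPureMultiPlaceAtTwo`, **DESC-43-M′** `SpinObstructedOfThreeSwitchedOnPlacesAtTwo` (SIGN-FREE) —
theorem-candidates modulo LAW36′; TAGS = the planner's (= REF1 §283: U/U′ corollary-of-print modulo the OFF-at-2 dictionary, T dictionary-level, L/A/B/M/M′ conjectural = LAW36′);
everything VERBATIM (sketch l.40–153), riders appended; the 7 glue theorems + REF1 K283.1–.7 to the kernel.  `0 < cubicDiscZ c` stays adjacent to every use of `EggAlignedUnitsAtTwo`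
(R274c).

THE MATHEMATICS (-desc g33; REF1-audited).  THE SINK CALCULUS (§43.0): `Q_v := 𝒰_v/(𝒲_v ∩ 𝒰_v)`, `Λ : Ũ → ⊕_v Q_v`, `ker Λ = Ũ ∩ Sel₂(W)`.  THM 43.0 (UNIT BOUND, spin-free): every place
OFF ∧ `h_L` odd ⟹ `Sel₂(W) ⊂ Ũ`, hence `#Sel₂ ≤ 4` (`Δ_L > 0`), `≤ 2` (`Δ_L < 0`), and `#Sel₂ = 4` ⟹ `Sel₂ = Ũ` ⟹ ALIGNED — = Yoo–Yu Thm 1.6 (upper clause) ∘ LEMMA 41.0 ∘ LEMMA 42.0,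
corollary of print, CHECKED on dim-2 curves: all-OFF dim-2 ⟹ aligned **4 217/4 217**, dim-3 ⟹ some place ON **163/163**, ENGINE 38 `Sel₂ = Ũ` exactly **150/150** (785 of the
4 217 at a 2-adic type with no print niceness criterion).  THM 43.1/43.2 (LONE ODD PLACE `v₀`, every other place OFF, `Δ_L > 0`, `Sel₂ = 0`): `U_{v₀} = loc(ker φ_∞ ∩ ker φ₂⁰)`;
the only sign-dependent odd cell is `(k, λ) = (0, 0)` = `I_n*`·c4·three roots·`4 ∣ n`, where `dim R ∩ N ∈ {0, 2}` forces **PURE ⟺ ALIGNED** (odd egg-rescue cell; never pure at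
`Δ_L < 0` = DESC-40-D); alignment exclusions at `d = 1` 𝔯-odd (0/504) and (1,1) (0/154 + 0/108).  THM 43.3 (MULTI-PLACE): pure ⟹ exactly two unit-rescued places ∧ aligned;
`≥ 3` ON never (sign-free).  BC5 = KIT j336972 (job43, PREDICTIONS43.md 7a4c371c6ed66103 frozen first, tokens + hash echoed in-job): PRIME-TWIST FAMILIES of Ũ-seeds — Selmer side
= Mazur–Rubin 2010 Prop 3.3 verbatim **1 642/1 642** twists; descent side ENGINE 38 **133/133** picks; spin side **133/133 picks AGREE with the frozen predictions** (67 PURE: 1 445/1 445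
pure primes law-ok; 66 NOT pure: 66/66 with ≥ 1 deviation; 0 DISAGREE · 0 LOWDATA · 0 INCONCLUSIVE; 3 303 pure primes ≤ 50 000); DECISIVE CONTRAST TAP (aligned Ũ-seed × split prime:
predicted PURE) 16/16 PURE (324/324) vs TCP (`Sel₂ = 0` seed × split prime: predicted NOT pure) 10/10 NOT pure (75 FAILs/224) — same local type at every place; TApq 10/10 PURE vs
TCpq 8/8 NOT; bound-only TAPQ 6/6 NOT pure; R274a control arms in-job (K0 all-OFF 8/8 PURE; §42 lone-2 cells; §40 odd cells; M2 8/8 NOT).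

PORT GATE = REF1-AUDIT §283 (2026-08-30T01:06:23Z) (-ref1 g23; `REF1-data/b283/`: Probe283 = sketch AS-IS + K283.1–.8, rc 0 · 0 warnings · std axioms, negative control rc 1 at the planted line;
tcell283.py c3cd3b7a51960cdf re-tally): **ALL 8 ROWS SURVIVE — no kill, no vacuity, no junk instance; exhaustiveness of L's right-hand side at a lone odd ON place RE-DERIVED
(additive odd `ℓ`: `W⁰(ℚ_ℓ)` 2-torsion-free ⟹ three roots force `I_n*`-c4, `n` even; multiplicative three roots ⟹ `n` even; ON odd cells = `d = 1` (𝔯 even/odd), (1,0), (1,1),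
(0,1), (0,0) — none missed; box lone odd ON places I₂ ×582, III ×184, I₄ c4 ×6, I₀* c2 ×5 all inside); A2: Yoo–Yu Thm 1.6 quoted from the held text ⟹ U/U′ corollary-of-print ∘ LEMMA
42.0 modulo «sharp-OFF ⟹ upper nice» at 2 (LEMMA 41.0, box-verified) — as labelled; TAP/TCP design free of hidden confounders in the TYPED rows (A/B speak of `W` alone; class-C
seeds are Λ-iso; B's mechanism does not use `φ₂⁰`; `D > 0` keeps alignment twist-invariant — R283e); MR 3.3 applies (twisted primes good for `E₀`).**  Riders: **R283a** (data, to
-desc and -data: L's clause «lone (0,1) = `I_{4m+2}*`-c4 three roots, `Δ_L > 0` ⟹ not pure even if aligned» has NO instance in job40–43 — arm proposed), **R283b** (M′ has no instance —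
TApqr/TAPpq arm; typed-but-untested), **R283c** (`selmerTwoCard W = 1` in DESC-43-T is LOAD-BEARING: 318 ALIGNED dim-Sel₂-2 curves carry a lone T-cell place — e.g. X26n1838, X31n202,
X12n502), **R283d** (inside `OddEggRescueCellAt`, `SwitchedOnSharpAt` ⟺ `¬HasGoodReductionAt v` given the other conjuncts — K283.5/.6; keep the conjunct, it is the usable form; the
tree links `Kod = I_n*` to «not good» only via the named fact `isGood_kodairaSymbolAt_iff`), **R283e** (scope: alignment twist-invariant only for `D > 0`), **R283f** (REF2 placement
input: THM 43.0 = Yoo–Yu 1.6 ∘ LEMMA 42.0 known; THM 43.2's `{0,2}` dichotomy and the TAP/TCP contrast — no print statement found by REF1 either; Selmer side of the twist families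
= MR 2010 verbatim).  PARTITION none; beyond-print theorem (kernel): no.

REF2 PLACEMENT: asked by -desc 00:56:49Z (THM 43.2's cell + twist contrast; -desc's P43.3 null in corpus fts+vec and galaxy, `lit/presearch43.txt`) — NOT YET POSTED at port time;
to be folded by a docstring-only v2 (REF1's reading for the record, R283f: U/U′ known-type, T dictionary-level, L/A/B/M new-combination beyond print).
BSD is not proved by this; 23715 is not closed by this.
-/

noncomputable section

open scoped Classical
open WeierstrassCurve Literature.NumberTheory.EllipticCurves Literature.NumberTheory.DiophantineGeometry Polynomial IsDedekindDomain NumberField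

namespace Summit.BirchSwinnertonDyer.Rank1Residual.F1Sign2

/-! ### §43 vocabulary -/

/-- THE ODD EGG-RESCUE CELL at a place `v ∣ ℓ`, `ℓ` odd: switched ON (sharp; at odd `ℓ` this is §39's `SwitchedOnAt`), type `I_n*` with FOUR rational components
(`c_v = 4`), three local roots of the 2-division cubic, and `4 ∣ n` (incl. `I₀*`): THM 40.1's cell `(k, λ) = (0, 0)` (`𝒲_v ∩ 𝒰_v = 0`; `λ = 0` by LEMMA 40.L since
`b ≡ (n/2, n/2, 0) + (2,2,2)`).  The local type of every admissible split-prime twist `E₀^{(P)}` at `P`.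
(RIDER, typer -ty g21: carrier, PLAIN `def`.  REF1-AUDIT §283: FAITHFUL — `n = 0` (I₀*) INCLUDED as intended (the twist places); at odd `ℓ` the `Sharp` disjuncts are inert;
K283.5/K283.6 (kernel sibling): given `ℓ ≠ 2`, `c_v = 4`, three roots, `I_n*`, NO §39 OFF disjunct can fire except `HasGoodReductionAt`, so inside the cell `SwitchedOnSharpAt` ⟺
`¬ W.HasGoodReductionAt v` (`switchedOnSharpAt_of_cell_data`, `oddEggRescueCell_not_good`); the tree links `Kod = I_n*` to «not good» only through the NAMED FACT
`isGood_kodairaSymbolAt_iff` (TateAlgorithm.lean), so keeping the conjunct is the right typing (R283d — it is what makes the twist places provably ON from their local data);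
K283.1: disjoint from `AlignmentExcludingOddCellAt`.) -/
def OddEggRescueCellAt (W : WeierstrassCurve ℚ) (c F : ℤ[X]) (v : HeightOneSpectrum (𝓞 ℚ)) (ℓ : ℕ) : Prop :=
  ℓ ≠ 2 ∧ SwitchedOnSharpAt W c F v ℓ ∧ ThreeLocalRootsC c ℓ ∧ W.tamagawaNumberAt v = 4 ∧ ∃ n : ℕ, W.kodairaSymbolAt v = KodairaSymbol.Istar n ∧ 4 ∣ n

/-- THE VISIBLE LONE-ODD-PLACE CELLS that EXCLUDE ALIGNMENT (THM 43.2): `d = 1` with the conductor `𝔯` odd above `ℓ` (COR 37.2's cell), or three local roots and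
multiplicative `I_n` with `n ≡ 2 (mod 4)` (cell (1,1), split or not).  In both, `dim U_v` is forced below `2`, so `P_∞ ≠ Ũ`.
(RIDER, typer -ty g21: carrier, PLAIN `def`.  REF1-AUDIT §283: = THM 43.2's cells `d = 1, 𝔯 odd` and (1,1) ✓; K283.2/K283.3 (kernel sibling): an alignment-excluding cell is
neither sharp-OFF nor `RescuableSharpAt` (𝔯 odd kills LAW 40's one-root clause, one root kills the split-`I_{4m}` clause, `n % 4 = 2` vs `4 ∣ n`, `ℓ ≠ 2` the additive
clauses); hence K283.4 `LAW 43 ⟹ ¬Fits` at every lone alignment-excluding place (`notFits_of_law43_alignmentExcluding`) — DESC-43-L contains DESC-40-B's obstruction shape at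
`Δ_L > 0`, consistent with DESC-43-T (which adds the spin-free «not aligned»).) -/
def AlignmentExcludingOddCellAt (W : WeierstrassCurve ℚ) (c F : ℤ[X]) (v : HeightOneSpectrum (𝓞 ℚ)) (ℓ : ℕ) : Prop :=
  ℓ ≠ 2 ∧ SwitchedOnSharpAt W c F v ℓ ∧
    ((OneLocalRootC c ℓ ∧ ConductorOddAboveOneRoot F ℓ) ∨
      (ThreeLocalRootsC c ℓ ∧ W.HasMultiplicativeReductionAt v ∧ ∃ n : ℕ, W.kodairaSymbolAt v = KodairaSymbol.I n ∧ n % 4 = 2))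

/-! ### §43 rows -/

/-- **DESC-43-U `EggAlignedOfSelmerFourAllOffAtTwo` (THM 43.0, dim-2 case; plain `def`, spin-free, theorem-grade modulo the OFF dictionary).**
`W(ℚ)[2] = 0`, `h_L` odd, `Δ_L > 0`, EVERY place switched off (sharp), `#Sel₂(W) = 4` ⟹ the units are ALIGNED (indeed `Sel₂(W) = Ũ`).  The companion of DESC-42-T
(`#Sel₂ = 1` ⟹ not aligned): in the all-OFF regime the real place is a Selmer datum.  Data (kit job43 stage 1, S43.0): every all-OFF curve among the `dim Sel₂ = 2`
candidates of the box is aligned, and ENGINE 38 finds all three norm-one classes with `F = ∅`.  Why it might fail: only through the OFF dictionary (`𝒲_v = H¹_nr` at OFF odd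
places, `𝒲₂ ⊂ 𝒰₂` at an OFF 2).  Sources: MEMO-desc §41 (LEMMA 41.0), §42 (THM 42.2), §43.0; [cite: BrumerKramer1977, §7]; [cite: YooYu2022, Thm. 1.6].
(RIDER, typer -ty g21: PLAIN per the planner / REF1 §283 — corollary-of-print modulo the OFF-at-2 dictionary.  REF1-AUDIT §283: **SURVIVES** — A2: Yoo–Yu Thm 1.6 verbatim
(held text arXiv 2005.00194 p. 4 L23–31: «if E is upper nice at all finite primes of K, then dim Sel₂(E/K) ≤ n + [K:ℚ]», `n = dim C^∞_L[2] − dim C⁺_K[2]`; `K = ℚ`, `h_L` odd ⟹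
`n = [ALIGNED]` by LEMMA 42.0 = REF2 §274 (a)) ⟹ not aligned ⟹ `#Sel₂ ≤ 2`, aligned ⟹ `≤ 4` — this row (contrapositive) and DESC-43-U′, GIVEN «sharp-OFF at `v` ⟹ upper nice at
`v`»: print at odd `v` and at a good / odd-multiplicative / rootless-additive `2`
[cite: YooYu2022, Thm. 1.6, Thm. 1.10, Thm. 1.11]
-desc's LEMMA 41.0 at the 785 other 2-adic types (box-verified, not print); THM 43.0's own three-line proof re-derived ✓; `0 < cubicDiscZ c` implied by `#Sel₂ = 4` + U′,
harmless; satisfiable: 4 217 all-OFF dim-2 curves (job43 S43.0: aligned 4 217/4 217; ENGINE 38 `Sel₂ = Ũ` 150/150).  REF2 placement: owed (R283f input: known-type).) -/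
def EggAlignedOfSelmerFourAllOffAtTwo : Prop :=
  ∀ (W : WeierstrassCurve ℚ) [W.IsElliptic] [W.IsGloballyMinimal] [Fact (Irreducible (twoDivisionUCubic W))],
    ∀ (c xnum : ℤ[X]) (xden : ℕ) (B2 B4 B6 : ℤ), CubicDatumFor W c xnum xden → BInvariantsZ W B2 B4 B6 →
      selmerTwoCard W = 4 → DegOnePrimesOddClassC c → 0 < cubicDiscZ c →
        (∀ (v : HeightOneSpectrum (𝓞 ℚ)) (ℓ : ℕ), PlaceOver v ℓ → SwitchedOffSharpAt W c (twoDivisionCubicZ B2 B4 B6) v ℓ) →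
          EggAlignedUnitsAtTwo W

/-- **DESC-43-U′ `SelmerTwoCardLeOfAllOffAtTwo` (THM 43.0, the bound; plain `def`, spin-free, sign-free).**  `W(ℚ)[2] = 0`, `h_L` odd, every place switched off (sharp)
⟹ `#Sel₂(W) ≤ 4`, and `≤ 2` when `Δ_L < 0` (`Sel₂ ⊂ Ũ`).  Data (kit job43 stage 1, S43.0′): none of the `dim Sel₂ = 3` curves of the box is all-OFF.  A Brumer–Kramer /
Yoo–Yu-type bound with OFF in place of NICE at `2`.  Sources: as DESC-43-U.
(RIDER, typer -ty g21: PLAIN, sign-free.  REF1-AUDIT §283: **SURVIVES** (as DESC-43-U: Yoo–Yu 1.6 ∘ LEMMA 42.0 modulo «sharp-OFF ⟹ upper nice» at 2; `cubicDiscZ c ≠ 0` automatic for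
an irreducible cubic, so the two clauses cover both signs; `dim Ũ = 2 / 1` for `Δ_L > 0 / < 0` re-derived: `𝓞ˣ/□ ≅ (ℤ/2)^{r+1}`, `N` onto `{±1}`); satisfiable by any all-OFF curve;
job43 S43.0′: none of the `dim Sel₂ = 3` curves of the box is all-OFF (163/163 have a place ON).  REF2 placement: owed (R283f: known-type).) -/
def SelmerTwoCardLeOfAllOffAtTwo : Prop :=
  ∀ (W : WeierstrassCurve ℚ) [W.IsElliptic] [W.IsGloballyMinimal] [Fact (Irreducible (twoDivisionUCubic W))],
    ∀ (c xnum : ℤ[X]) (xden : ℕ) (B2 B4 B6 : ℤ), CubicDatumFor W c xnum xden → BInvariantsZ W B2 B4 B6 →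
      DegOnePrimesOddClassC c →
        (∀ (v : HeightOneSpectrum (𝓞 ℚ)) (ℓ : ℕ), PlaceOver v ℓ → SwitchedOffSharpAt W c (twoDivisionCubicZ B2 B4 B6) v ℓ) →
          selmerTwoCard W ≤ 4 ∧ (cubicDiscZ c < 0 → selmerTwoCard W ≤ 2)

/-- **DESC-43-L `LevelZeroSpinLawPosDiscLoneOddPlaceAtTwo` (LAW 43: THE LEVEL-0 LAW AT A LONE ODD PLACE IN THE TOTALLY REAL REGIME; `@[conjecture]`, `↔`,
theorem-candidate modulo LAW36′; MEMO-desc §43.1).**  Setting of LAW36 with the b-invariant cubic, `Sel₂(W) = 0`, `h_L` odd, `Δ_L > 0`, an odd place `v₀ ∣ ℓ₀` with every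
OTHER place switched off (sharp).  PURE ⟺ `v₀` is OFF, or RESCUABLE (LAW 40: `d = 1` 𝔯-even, or split `I_{4m}` with three roots), or in the ODD EGG-RESCUE CELL with ALIGNED
units.  Mechanism: THM 43.2 (`U_{v₀} = ker φ_∞ ∩ ker φ₂⁰`, THM 40.1's table, the `{0,2}`-dichotomy in cell (0,0)) + LAW36′.  Extends LAW 40's lone-place clauses
(DESC-40-A/B/D, stated for `Δ_L < 0` or sign-free) to `Δ_L > 0`; the only sign-dependent odd cell is (0,0).  BC5: kit job43 (pre-registered PREDICTIONS43.md): census arms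
OS10 / OS11 / ON11 / OD1e / OD1o and the twist arms TAP (aligned, predicted pure) vs TCP (not aligned, predicted not pure) — the odd egg-rescue cell has NO `Sel₂ = 0`
representative in the box (0 of 9 618), so its witnesses are the split-prime twists of Ũ-seeds.  Why it might fail: LAW36′; `U_{v₀} = P` uses `h_L` odd and the OFF
dictionary at every other place incl. the 2-sink; a (0,0) twist with `Sel₂ = 0`, aligned, yet deviating would refute ⟸.  Sources: MEMO-desc §37, §40, §42, §43;
[cite: BrumerKramer1977, §7]; [cite: YooYu2022, Thm. 1.6]; PR12 arXiv:1104.2941 §4; [cite: MazurRubin2010, Prop. 3.3].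
(RIDER, typer -ty g21: `@[conjecture]` per the planner / REF1 §283 (LAW36′ side).  REF1-AUDIT §283: **SURVIVES** — new content = cell (0,0) ↔ aligned and the (0,1)-obstruction at
`Δ_L > 0`, the rest = DESC-40/41 rows; EXHAUSTIVENESS of the right-hand side at a lone odd switched-on place RE-DERIVED by REF1 (ON odd cells = `d = 1` (𝔯 even → `RescuableAt`;
𝔯 odd → T-cell), (1,0) split `I_{4m}` (→ `RescuableAt`), (1,1) `I_{4m+2}` (T-cell), (0,1) `I_{4m+2}*`-c4, (0,0) `I_{4m}*`-c4 — none missed; box lone odd ON places of the 9 618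
`Sel₂ = 0` curves: I₂ c2 ×582, III c2 ×184, I₄ c4 ×6, I₀* c2 ×5, all inside); the `{0,2}`-dichotomy behind A/B re-read and internally consistent; K283.7 (kernel sibling): the
OTHERS-OFF hypothesis and «two distinct sharp-ON places» are jointly contradictory — a genuinely LONE-place law (says nothing M/M′ say); K283.4: ⟹ ¬Fits at every lone
alignment-excluding place.  R283a (data): the clause «lone (0,1) = `I_{4m+2}*`-c4, three roots, `Δ_L > 0` ⟹ NOT pure, EVEN IF ALIGNED (`r = 1`)» is the one clause of LAW 43
with NO instance in job40–43 (box: 0 such lone places; twist arms make `n = 0` only) — arm proposed to -desc and -data (aligned dim-2 seeds with a lone (1,1) place `q`, 105 available,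
`D = q*·cofactor > 0`).  BC5: census arms OS10 / OS11 / ON11 / OD1e / OD1o + twist arms TAP 16/16 PURE vs TCP 10/10 NOT pure.  REF2 placement: owed (asked 00:56Z; R283f input:
THM 43.2's `{0,2}` dictionary in cell (0,0) and the TAP/TCP contrast — no print statement found by REF1 or -desc; Selmer side of the twist families =
[cite: MazurRubin2010, Prop. 3.3]
verbatim).) -/
@[conjecture] def LevelZeroSpinLawPosDiscLoneOddPlaceAtTwo : Prop :=
  ∀ (W : WeierstrassCurve ℚ) [W.IsElliptic] [W.IsGloballyMinimal] [Fact (Irreducible (twoDivisionUCubic W))],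
    ∀ (c xnum : ℤ[X]) (xden : ℕ) (B2 B4 B6 : ℤ), CubicDatumFor W c xnum xden → BInvariantsZ W B2 B4 B6 →
      selmerTwoCard W = 1 → DegOnePrimesOddClassC c → 0 < cubicDiscZ c →
        ∀ (v₀ : HeightOneSpectrum (𝓞 ℚ)) (ℓ₀ : ℕ), PlaceOver v₀ ℓ₀ → ℓ₀ ≠ 2 →
          (∀ (w : HeightOneSpectrum (𝓞 ℚ)) (ℓ : ℕ), PlaceOver w ℓ → w ≠ v₀ → SwitchedOffSharpAt W c (twoDivisionCubicZ B2 B4 B6) w ℓ) →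
            (CorrectedSpinLawFits W c xnum xden [] ↔
              (SwitchedOffSharpAt W c (twoDivisionCubicZ B2 B4 B6) v₀ ℓ₀ ∨ RescuableSharpAt W c (twoDivisionCubicZ B2 B4 B6) v₀ ℓ₀ ∨
                (OddEggRescueCellAt W c (twoDivisionCubicZ B2 B4 B6) v₀ ℓ₀ ∧ EggAlignedUnitsAtTwo W)))

/-- **DESC-43-A `PureSpinLawOfEggAlignedOddIstarAtTwo` (the new PURE cell; `@[conjecture]`, theorem-candidate modulo LAW36′).**  `Sel₂(W) = 0`, `h_L` odd, `Δ_L > 0`,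
ALIGNED units, a lone odd place in the egg-rescue cell ⟹ the pure law FITS (`r = 0`; moreover `Ũ ⊂ 𝒲₂`).  BC5 = twist arm TAP of kit job43.  A consequence of DESC-43-L.
(RIDER, typer -ty g21: `@[conjecture]`.  REF1-AUDIT §283: **SURVIVES** — a consequence of DESC-43-L (kernel `pureOddIstar_of_law43`, std axioms); the row speaks of `W` alone (no hidden
seed hypothesis; in the DATA the seed's Selmer group is confounded with alignment by necessity — all-OFF: `Sel₂(E₀) = Ũ ⟺` aligned); satisfiable by the TAP members (`E₀^{(D)}`,
`D = P·c > 0`, `D ≡ 1 (8)`; `P` is `I₀*`, `c_P = 4`, three `ℤ_P`-roots — ON by K283.6; alignment preserved since `D > 0`, R283e).  BC5 = twist arm TAP of kit job43: **16/16 PURE**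
(324/324 pure primes law-ok); one dimension down TApq 10/10 PURE (203/203).  REF2 placement: owed.) -/
@[conjecture] def PureSpinLawOfEggAlignedOddIstarAtTwo : Prop :=
  ∀ (W : WeierstrassCurve ℚ) [W.IsElliptic] [W.IsGloballyMinimal] [Fact (Irreducible (twoDivisionUCubic W))],
    ∀ (c xnum : ℤ[X]) (xden : ℕ) (B2 B4 B6 : ℤ), CubicDatumFor W c xnum xden → BInvariantsZ W B2 B4 B6 →
      selmerTwoCard W = 1 → DegOnePrimesOddClassC c → 0 < cubicDiscZ c → EggAlignedUnitsAtTwo W →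
        ∀ (v₀ : HeightOneSpectrum (𝓞 ℚ)) (ℓ₀ : ℕ), PlaceOver v₀ ℓ₀ →
          (∀ (w : HeightOneSpectrum (𝓞 ℚ)) (ℓ : ℕ), PlaceOver w ℓ → w ≠ v₀ → SwitchedOffSharpAt W c (twoDivisionCubicZ B2 B4 B6) w ℓ) →
            OddEggRescueCellAt W c (twoDivisionCubicZ B2 B4 B6) v₀ ℓ₀ → CorrectedSpinLawFits W c xnum xden []

/-- **DESC-43-B `SpinObstructedOfMisalignedOddIstarAtTwo` (`@[conjecture]`, theorem-candidate modulo LAW36′).**  Same cell, units NOT aligned ⟹ the pure law FAILS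
(`r = 2`, all three classes, exactly as at `Δ_L < 0`: DESC-40-D).  BC5 = twist arm TCP of kit job43.  A consequence of DESC-43-L.
(RIDER, typer -ty g21: `@[conjecture]`.  REF1-AUDIT §283: **SURVIVES** — a consequence of DESC-43-L (kernel `obstructedOddIstar_of_law43`); B's mechanism does not use `φ₂⁰`, so no
confounder leaks into the statement although class-C seeds are Λ-iso (ENGINE 38 F-sets `{2}`, `{0}`, `{2,0}`, e.g. TCP_X16n373).  BC5 = twist arm TCP: **10/10 NOT pure** (75
FAILs / 224 pure primes, 3–10 per curve); TCpq 8/8 NOT (78/185); bound-only TAPQ 6/6 NOT pure (seed alignment is not enough — THM 43.3).  REF2 placement: owed.) -/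
@[conjecture] def SpinObstructedOfMisalignedOddIstarAtTwo : Prop :=
  ∀ (W : WeierstrassCurve ℚ) [W.IsElliptic] [W.IsGloballyMinimal] [Fact (Irreducible (twoDivisionUCubic W))],
    ∀ (c xnum : ℤ[X]) (xden : ℕ) (B2 B4 B6 : ℤ), CubicDatumFor W c xnum xden → BInvariantsZ W B2 B4 B6 →
      selmerTwoCard W = 1 → DegOnePrimesOddClassC c → 0 < cubicDiscZ c → ¬ EggAlignedUnitsAtTwo W →
        ∀ (v₀ : HeightOneSpectrum (𝓞 ℚ)) (ℓ₀ : ℕ), PlaceOver v₀ ℓ₀ →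
          (∀ (w : HeightOneSpectrum (𝓞 ℚ)) (ℓ : ℕ), PlaceOver w ℓ → w ≠ v₀ → SwitchedOffSharpAt W c (twoDivisionCubicZ B2 B4 B6) w ℓ) →
            OddEggRescueCellAt W c (twoDivisionCubicZ B2 B4 B6) v₀ ℓ₀ → ¬ CorrectedSpinLawFits W c xnum xden []

/-- **DESC-43-T `NotEggAlignedOfLoneVisibleOddPlaceAtTwo` (THM 43.2's alignment exclusions; plain `def`, spin-free, theorem-grade modulo the dictionary).**
`Sel₂(W) = 0`, `h_L` odd, `Δ_L > 0`, a lone switched-on ODD place `v₀` which is `d = 1` with 𝔯 odd above it, or multiplicative `I_n`, `n ≡ 2 (4)`, with three local roots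
⟹ NOT aligned.  Data (kit j336660 box, re-tallied by job43 T1/T2): lone D1 𝔯-odd 0 aligned / 78, lone (1,1) split 0/154, non-split 0/108.  The odd analogue of DESC-42-T″/T′.
(RIDER, typer -ty g21: PLAIN (dictionary-level, spin-free; the odd analogue of DESC-42-T″/T′).  REF1-AUDIT §283: **SURVIVES**; **R283c (mutation, data): the hypothesis
`selmerTwoCard W = 1` is LOAD-BEARING** — REF1's re-tally `tcell283.py` c3cd3b7a51960cdf of job43 stage 1a finds, among the 5 985 `dim Sel₂ = 2` candidates, **318 ALIGNED curves
with a lone T-cell place** (`d = 1` 𝔯-odd: I₂ c2 ×135 / III ×77 / I₆ ×1; (1,1) I₂ three roots ×105; e.g. X26n1838, X31n202, X12n502) — the hypothesis-free form is FALSE, as the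
mechanism says (`loc_{v₀}` injective on `P` uses `Sel₂(W) = 0`); provers: keep it.  Data for the row as typed (`Sel₂ = 0`): lone D1 𝔯-odd 0 aligned / 504 (memo) resp. 78 (box
re-tally), lone (1,1) split 0/154, non-split 0/108.  REF2 placement: owed (R283f: dictionary-level, like DESC-42-T′/T″).) -/
def NotEggAlignedOfLoneVisibleOddPlaceAtTwo : Prop :=
  ∀ (W : WeierstrassCurve ℚ) [W.IsElliptic] [W.IsGloballyMinimal] [Fact (Irreducible (twoDivisionUCubic W))],
    ∀ (c xnum : ℤ[X]) (xden : ℕ) (B2 B4 B6 : ℤ), CubicDatumFor W c xnum xden → BInvariantsZ W B2 B4 B6 →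
      selmerTwoCard W = 1 → DegOnePrimesOddClassC c → 0 < cubicDiscZ c →
        ∀ (v₀ : HeightOneSpectrum (𝓞 ℚ)) (ℓ₀ : ℕ), PlaceOver v₀ ℓ₀ →
          (∀ (w : HeightOneSpectrum (𝓞 ℚ)) (ℓ : ℕ), PlaceOver w ℓ → w ≠ v₀ → SwitchedOffSharpAt W c (twoDivisionCubicZ B2 B4 B6) w ℓ) →
            AlignmentExcludingOddCellAt W c (twoDivisionCubicZ B2 B4 B6) v₀ ℓ₀ → ¬ EggAlignedUnitsAtTwo W

/-- **DESC-43-M `TwoRescuedPlacesOfPureMultiPlaceAtTwo` (THM 43.3, `⟹` direction; `@[conjecture]`, theorem-candidate modulo LAW36′).**  `Sel₂(W) = 0`, `h_L` odd,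
`Δ_L > 0`, two DISTINCT switched-on places `v₁`, `v₂` and the pure law FITS ⟹ there is no third switched-on place, both are rescuable (sharp), and the units are ALIGNED
(`Λ : Ũ ≅ Q_{v₁} ⊕ Q_{v₂}` kills `φ_∞`).  BC5: twist arm TApq (two transposition primes, predicted pure) vs TCpq / TAPQ; census arm M (13 multi-place curves, all with an
`I₂` place: predicted not pure).  Refines DESC-41-B's multi-place clause by the alignment conclusion.
(RIDER, typer -ty g21: `@[conjecture]`.  REF1-AUDIT §283: **SURVIVES** — THM 43.3's count re-derived (PURE at `v ∈ S` needs a non-zero `u_v ∈ ⋂_{w ≠ v} ker Λ_w ∖ ker Λ_v`; with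
`ker Λ = Ũ ∩ Sel₂ = 0` these are independent, so `|S| ≤ dim Ũ = 2`; a pair containing the place `2` is never pure since `dim Q₂ ≥ 2` when `2` is ON, so the conclusion is only
ever instantiated by two odd places — consistent, not a defect); kernel `threeOn_of_twoRescued` (M ⟹ M′ at `Δ_L > 0`).  BC5: TApq **10/10 pure** vs TCpq 8/8 / TAPQ 6/6 / M2
13/13 not pure.  REF2 placement: owed.) -/
@[conjecture] def TwoRescuedPlacesOfPureMultiPlaceAtTwo : Prop :=
  ∀ (W : WeierstrassCurve ℚ) [W.IsElliptic] [W.IsGloballyMinimal] [Fact (Irreducible (twoDivisionUCubic W))],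
    ∀ (c xnum : ℤ[X]) (xden : ℕ) (B2 B4 B6 : ℤ), CubicDatumFor W c xnum xden → BInvariantsZ W B2 B4 B6 →
      selmerTwoCard W = 1 → DegOnePrimesOddClassC c → 0 < cubicDiscZ c →
        ∀ (v₁ v₂ : HeightOneSpectrum (𝓞 ℚ)) (ℓ₁ ℓ₂ : ℕ), v₁ ≠ v₂ → PlaceOver v₁ ℓ₁ → PlaceOver v₂ ℓ₂ →
          SwitchedOnSharpAt W c (twoDivisionCubicZ B2 B4 B6) v₁ ℓ₁ → SwitchedOnSharpAt W c (twoDivisionCubicZ B2 B4 B6) v₂ ℓ₂ →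
            CorrectedSpinLawFits W c xnum xden [] →
              (∀ (w : HeightOneSpectrum (𝓞 ℚ)) (ℓ : ℕ), PlaceOver w ℓ → SwitchedOnSharpAt W c (twoDivisionCubicZ B2 B4 B6) w ℓ → w = v₁ ∨ w = v₂) ∧
                RescuableSharpAt W c (twoDivisionCubicZ B2 B4 B6) v₁ ℓ₁ ∧ RescuableSharpAt W c (twoDivisionCubicZ B2 B4 B6) v₂ ℓ₂ ∧ EggAlignedUnitsAtTwo W

/-- **DESC-43-M′ `SpinObstructedOfThreeSwitchedOnPlacesAtTwo` (THM 43.3's counting clause; `@[conjecture]`, SIGN-FREE, theorem-candidate modulo LAW36′).**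
`Sel₂(W) = 0`, `h_L` odd, three pairwise distinct switched-on places ⟹ the pure law FAILS (`dim Ũ ≤ 2` cannot cover three independent sinks; at `Δ_L < 0` already two
suffice — THM 39.2).  The first multi-place row with no sign hypothesis.
(RIDER, typer -ty g21: `@[conjecture]`, SIGN-FREE.  REF1-AUDIT §283: **SURVIVES as a statement but has NO data instance (R283b)** — crosstab `≥ 3` ON places: 0 in job43
(arms have ≤ 2 twisted places); plainly satisfiable (three transposition primes); cheapest arm TApqr / TAPpq (predicted not pure for every seed class) — until then
TYPED-BUT-UNTESTED; at `Δ_L < 0` two ON places already suffice (THM 39.2 / DESC-41-B).  REF2 placement: owed.) -/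
@[conjecture] def SpinObstructedOfThreeSwitchedOnPlacesAtTwo : Prop :=
  ∀ (W : WeierstrassCurve ℚ) [W.IsElliptic] [W.IsGloballyMinimal] [Fact (Irreducible (twoDivisionUCubic W))],
    ∀ (c xnum : ℤ[X]) (xden : ℕ) (B2 B4 B6 : ℤ), CubicDatumFor W c xnum xden → BInvariantsZ W B2 B4 B6 →
      selmerTwoCard W = 1 → DegOnePrimesOddClassC c →
        ∀ (v₁ v₂ v₃ : HeightOneSpectrum (𝓞 ℚ)) (ℓ₁ ℓ₂ ℓ₃ : ℕ), v₁ ≠ v₂ → v₁ ≠ v₃ → v₂ ≠ v₃ →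
          PlaceOver v₁ ℓ₁ → PlaceOver v₂ ℓ₂ → PlaceOver v₃ ℓ₃ →
            SwitchedOnSharpAt W c (twoDivisionCubicZ B2 B4 B6) v₁ ℓ₁ → SwitchedOnSharpAt W c (twoDivisionCubicZ B2 B4 B6) v₂ ℓ₂ →
              SwitchedOnSharpAt W c (twoDivisionCubicZ B2 B4 B6) v₃ ℓ₃ → ¬ CorrectedSpinLawFits W c xnum xden []

end Summit.BirchSwinnertonDyer.Rank1Residual.F1Sign2

end
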